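import Summits.QuantumFields.YangMills.Theorems.BalabanUVNodesN08AtRecord13CoP
import Summits.QuantumFields.YangMills.Theorems.BalabanUVNodesN08AtRecord13Family

/-!
# v1.5 `CoP` EDITION — director-ym LINE №160 ∕ №162 ((y) FINAL, EDITION FREEZE): RECORD 13 re-seeded at print's COLLAR-ranged background class (node00-def-R FILE 22′
# `LargeFieldBackgroundCoPOfRecord`, `UbgMSCoPOfRecord`) and the collar-exempt 𝐓-weights (def-T 12a″); def-T FILE 23 `Node00/Record13CoP` (p520810) + 24T `Node00/Record13SepCoP`
# (p521293), token tables KEY-23 ∕ KEY-24T = «the v1.4 names with `Co ↦ CoP`» (`toStage5₁₃CoP`, `datumOfRecord₁₃CoP`, `IsRecordOfRecord₁₃CCoP`, `Provisos₁₃SepCoP`, `datumOfRecord₁₃SepCoP`,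
# `IsRecordOfRecord₁₃CSepCoP(.toCoP)`; `Provisos₁₃Core` token-identical), dag-n10-d's CoP carrier leaves `Node00/Record13CarriersCoP ∕ Record13CarriersSepCoP` (`toStage5₁₃CoP_pin<G> ∕ _rebindX`,
# `view₁₃CoPB10YZW(_eq)`, `datumOfRecord₁₃(Sep)CoP_pin<G>`, `isRecordOfRecord₁₃C(Sep)CoP_pinB10_of_eq ∕ _rebindX_of_eq`, `exists_world_isRecordOfRecord₁₃CCoP_rebindX`).  THIS FILE is the verbatim token
# image (of `BalabanUVNodesN08AtRecord13CoFamily` (p519575)) under that table (generator `tools/cop_n08_gen.py`); statement SHAPES and proofs identical up to the tokens; the source module stays as the v1.4 sibling.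
#
# BalabanUVNodes ∕ N08 ON THE STAGE-13 WITNESS FAMILIES, AT PRINT'S BACKGROUND — the CoP ∕ Core re-key (KEY-RULE-21) of `BalabanUVNodesN08AtRecord13Family` (p494431):
# N08's share of a Core-keyed ₁₃ nodes-∃ WITNESSED AT node00-def-K0a's all-numerics family `θ₁₃(n, ε₂₉) = Node00.theta13LiveOfNumerics F N n ε₂₉ …` and two-letter family
# `θ₁₃(ε₀, ε₂₉) = Node00.theta13LiveOfFamily₂ …` (θ-level makers, background-free), where it costs the Core provisos there + `PrintedUV3V N F.L`; and THE SUPPLIER CURRENCIES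
# OF THAT SLOT AT THE FAMILY'S OWN BLOCK SIZE `F.L` (Track A, DAG node N08 [Balaban1985UV3] CMP **102** (1985) 255, Thm 1 p. 257 (compact reading) + Thm 2 p. 272; R134 fan-out seat
# `pub-ymgap-dag-n08-c` g15, strategy s2 «knit at the record of record», trigger (t19‴) = def-T KEY-21C → KEY-23; dag-lead ORPHAN-STOREYS row A1 (file 2 of 5), 2026-08-27)

WHY THIS FILE.  p494431 is keyed on the v1.1 provisos `Provisos₁₃`, the U_old datum `datumOfRecord₁₃`, record `IsRecordOfRecord₁₃C` and view `toStage5₁₃`; under director-ym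
LINE №152 RULING (β) the record of RECORD 13 is re-based ONCE at print's background (def-T FILE 23 `Node00/Record13CoP`, dag-n10-d's `Node00/Record13CarriersCoP`), so its
witness-line theorems are re-typed here as IMAGES under KEY-RULE-21 (`IsRecordOfRecord₁₃C ↦ IsRecordOfRecord₁₃CCoP`, `(h : Provisos₁₃) ↦ (h : Provisos₁₃Core)`, `datumOfRecord₁₃ ↦
datumOfRecord₁₃CoP`, `toStage5₁₃ ↦ toStage5₁₃CoP`) over this seat's CoP storey `BalabanUVNodesN08AtRecord13CoP` (§2 `exists_world₁₃CCoP_b10_main_of_slot`, §1 `b10_main_iff_of_up_pinB10`).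
The makers `theta13LiveOfNumerics ∕ theta13LiveOfFamily₂` and K0a's faces `admissible_ ∕ ztUnity_ ∕ slotsNondegenerate₁₃_…_of_hasResiduals` are θ-level and background-free
(`UbgOfRecord₁₃` occurs in `Node00/Record13LiveSelector(Family)` only inside `hbg` SOCKET hypotheses), so they serve verbatim.  NOT imaged: p494431's six `…_of_bg_…` forms
(their hypothesis is K0a's U_old row-P11 socket text at `UbgOfRecord₁₃`; the CoP socket is node00-def-K0a's 15a ∕ 15b, not this seat's) — in their place §3b composes the three
supplier currencies into the proviso-OPAQUE `_two` form; and p494431's five `rfl` faces (`theta13LiveOfNumerics_L ∕ _γ`, `theta13LiveOfFamily₂_L`, `…_eq_…_at_record`),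
θ-level, CITED from p494431 (dag-lead DEDUP-113).

WHAT THIS FILE PROVES (kernel bookkeeping BY NAME; 0 `def`, 0 `sorry`).
* §1 AT `θ₁₃(n, ε₂₉)`: `exists_world₁₃CCoP_b10_main_at_theta13LiveOfNumerics (hn : n.Pos) (hε' : 0 < ε₂₉) (hP : Provisos₁₃Core) (hUV : PrintedUV3V N F.L)` — a world of the
  member's CoP datum (`w.γ = n.γ`, `w.L = F.L`) bound over the [B10]-pinned CoP view, a ₁₃CCoP record carrying N08 at every run; `b10_main_iff_at_theta13LiveOfNumerics` (exact cost
  «in-edges → `PrintedUV3V N F.L`»); at `N = 2`: `exists_guarded_record₁₃CCoP_b10_main_of_theta13Numerics_provisosCore_two` (guard = K0a's HYPOTHESIS-FREE row P12).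
* §2 AT `θ₁₃(ε₀, ε₂₉)`: `exists_world₁₃CCoP_b10_main_at_theta13LiveOfFamily₂ (hε : 0 < ε₀) (hε')`, `exists_guarded_record₁₃CCoP_b10_main_of_theta13Family₂_provisosCore_two`.
* §3 SUPPLIER CURRENCIES AT `L := F.L` into §1 (generic `N`): `exists_world₁₃CCoP_b10_main_at_theta13LiveOfNumerics_of_uniformLeafSystemsG ∕ _of_thm1Compact_perRun ∕
  _of_perRunUniformO1` — (u) uniform leaf systems (dag-n08-a `printedUV3V_of_uniformLeafSystems_at`), (r) «relative to (5)» (dag-n08-e `printedUV3V_of_thm1Compact_perRun`),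
  (o) per-run data with a run-uniform O(1) (dag-n08-a `printedUV3V_of_perRunUniformO1`); §3b the same three INTO N08's conjunct at the member, `N = 2`, provisos opaque:
  `exists_guarded_record₁₃CCoP_b10_main_of_theta13Numerics_provisosCore_two_of_uniformLeafSystemsG ∕ _of_thm1Compact_perRun ∕ _of_perRunUniformO1`.
HONEST FRAMING.  Count-neutral re-keying of a LANDED storey to the corrected record (new file; p494431 stays as the pre-№152 sibling); nothing of Bałaban's asserted: `n.Pos`,
`0 < ε₂₉` (`0 < ε₀`), `Provisos₁₃Core`, and `PrintedUV3V` or its supplier data are DISPLAYED hypotheses on every theorem; `Node00.PrintedUV3V` is TYPED, NOT PROVED — an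
inhabitant (the [B10] cluster expansion at print's run objects) remains THE object gap of N08; K0 ∕ K1 neither proved nor assumed; N08 NOT discharged; one finite four-torus per
run at fixed `ε`, [B10]'s d = 3 lattices inside the record; nothing continuum ∕ ℝ⁴ ∕ OS ∕ mass gap ∕ Clay.
Sources: [Balaban1985UV3] Thm 1 p.257, Thm 2 p.272, Sect. D pp.272–275; [Balaban1989LargeFieldII] Thm 1 + (0.1) pp.355–356; [Balaban1988Convergent] Thm 1 p.262,
(2.18) p.257, (3.16)–(3.22) pp.268–269; [Balaban1987RG1] (0.1) p.251, (0.21) p.256, (2.9) p.266; [Balaban1989LargeFieldI] (0.3)–(0.4) p.176; [Balaban1985Averaging] (10) p.19.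
-/

noncomputable section

namespace Summit.QuantumFields.YangMills.BalabanUVNodes.N08AtRecord13CoPFamily

open Literature.MathematicalPhysics.QuantumFieldTheory.Balaban1983to89
open Literature.MathematicalPhysics.QuantumFieldTheory.Balaban1983to89.T4Continuum (T4Family FiniteEpsData)
open Literature.MathematicalPhysics.QuantumFieldTheory.Balaban1983to89.DagBinding (WorldP leavesP)
open Literature.MathematicalPhysics.QuantumFieldTheory.Balaban1983to89.Node00
open Literature.MathematicalPhysics.QuantumFieldTheory.Balaban1983to89.B10RunsOfRecord (Consts UniformLeafSystemsG runObjects₀T Backgrounds runsAtG)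
open Literature.MathematicalPhysics.QuantumFieldTheory.Balaban1985CMP102
open Literature.MathematicalPhysics.QuantumFieldTheory.Balaban1985CMP102.Setting
open Literature.MathematicalPhysics.QuantumFieldTheory.Balaban1985CMP102.Theorems (Family)
open Summit.QuantumFields.YangMills.BalabanUVNodes.N08AtRecord13CoP
open Summit.QuantumFields.YangMills.BalabanUVNodes.N08AtRecord9CB10 (printedUV3V_of_uniformLeafSystems_at)
open Summit.QuantumFields.YangMills.Theorems.BalabanUVNodesN08RelativeTo5 (printedUV3V_of_thm1Compact_perRun)
open Summit.QuantumFields.YangMills.Theorems.BalabanUVNodesN08UniformO1 (printedUV3V_of_perRunUniformO1)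
open scoped Matrix.Norms.L2Operator

/-! ## §1 ON THE ALL-NUMERICS STAGE-13 WITNESS FAMILY `θ₁₃(n, ε₂₉) = theta13LiveOfNumerics F N n ε₂₉ (zeta316OfRecord F N n.ν n.τ9.M n.A₁) (RzOfRecord F N) (ZtOfRecord F N)`
(K0b's residuals of record; block size `F.L`, window `n.γ`) — N08's share costs `PrintedUV3V N F.L` -/

section Numerics
variable (F : T4Family) (N : ℕ) [NeZero N] {n : Stage12Numerics} {ε₂₉ : ℝ}

/-- **N08's SHARE OF THE STAGE-13 NODES STUB AT ANY MEMBER `θ₁₃(n, ε₂₉)` COSTS THE SINGLE PROP `PrintedUV3V N F.L`** (plus the Core provisos `hP` at the member, HYPOTHESIS,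
and the two displayed signs `n.Pos`, `0 < ε₂₉` under which K0a's `admissible_theta13LiveOfNumerics` gives admissibility): a world of the member's datum of record (`w.γ = n.γ`,
`w.L = F.L`), bound over the [B10]-pinned CoP view of the member, that IS a ₁₃CCoP record and carries N08 at every run (the CoP storey's §2 `exists_world₁₃CCoP_b10_main_of_slot`).
At `N = 2`: [Balaban1985UV3] Thm 1-compact ∧ Thm 2 with their printed ∃-prefix for SU(2) at the family's block size `F.L`, at some version of print's transformations.
[cite: Balaban1985UV3, Thm 1 p.257, Thm 2 p.272; Balaban1989LargeFieldII, Thm 1 + (0.1) pp.355–356; Balaban1987RG1, (0.21) p.256, (2.9) p.266 (bookkeeping)] -/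
theorem exists_world₁₃CCoP_b10_main_at_theta13LiveOfNumerics (hn : n.Pos) (hε' : 0 < ε₂₉)
    (hP : (theta13LiveOfNumerics F N n ε₂₉ (zeta316OfRecord F N n.ν n.τ9.M n.A₁) (RzOfRecord F N) (ZtOfRecord F N)).Provisos₁₃Core F N)
    (hUV : PrintedUV3V N F.L) :
    ∃ w : WorldP,
      IsRecordOfRecord₁₃CCoP F N
          (datumOfRecord₁₃CoP F N (theta13LiveOfNumerics F N n ε₂₉ (zeta316OfRecord F N n.ν n.τ9.M n.A₁) (RzOfRecord F N) (ZtOfRecord F N)) hP) w ∧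
        w.γ = n.γ ∧ w.L = (F.L : ℝ) ∧
        (∀ P, w.up P = upOfRecord₅C F N
          (((theta13LiveOfNumerics F N n ε₂₉ (zeta316OfRecord F N n.ν n.τ9.M n.A₁) (RzOfRecord F N) (ZtOfRecord F N)).pinB10 F N).toStage5₁₃CoP F N) P) ∧
        ∀ P : B12.RunParams, Dag.B10_main (leavesP w P) :=
  have hθ := admissible_theta13LiveOfNumerics F N (zeta316OfRecord F N n.ν n.τ9.M n.A₁) (RzOfRecord F N) (ZtOfRecord F N) hn hε'
  exists_world₁₃CCoP_b10_main_of_slot _ hP hθ (γw := n.γ) ⟨hθ.toStage9.gamma_pos, le_rfl⟩ hUV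

/-- **EXACT COST AT THE MEMBER**: at any world bound over the [B10]-pinned view of `θ₁₃(n, ε₂₉)`, N08 at a run ⟺ «in-edge leaves ⟹ `PrintedUV3V N F.L`». [cite: Balaban1985UV3, Thm 1 p.257, Thm 2 p.272] -/
theorem b10_main_iff_at_theta13LiveOfNumerics {w : WorldP}
    (hup : ∀ P, w.up P = upOfRecord₅C F N
      (((theta13LiveOfNumerics F N n ε₂₉ (zeta316OfRecord F N n.ν n.τ9.M n.A₁) (RzOfRecord F N) (ZtOfRecord F N)).pinB10 F N).toStage5₁₃CoP F N) P)
    (P : B12.RunParams) :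
    Dag.B10_main (leavesP w P) ↔
      ((leavesP w P).b5 → (leavesP w P).b6 → (leavesP w P).b7 → (leavesP w P).b8 → (leavesP w P).b9 → (leavesP w P).b11 → PrintedUV3V N F.L) :=
  b10_main_iff_of_up_pinB10 _ hup P

/-- **N08's CONJUNCT OF THE STAGE-13 NODES-∃, WITNESSED AT THE MEMBER `θL F n ε₂₉`, `N = 2`** — from the Core provisos at the member (`hP : Provisos₁₃Core`, HYPOTHESIS), the signs
`n.Pos`, `0 < ε₂₉`, and `PrintedUV3V 2 F.L`: the guard (K0a's HYPOTHESIS-FREE `ztUnity_theta13LiveOfNumerics` ∕ `slotsNondegenerate₁₃_theta13LiveOfNumerics_of_hasResiduals`) and admissibility are K0a's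
theorems BY NAME.  NOT the stub, NOT a discharge. [cite: Balaban1985UV3, Thm 1 p.257, Thm 2 p.272; Balaban1988Convergent, Thm 1 p.262, (3.16)–(3.22) pp.268–269; Balaban1989LargeFieldI, (0.3)–(0.4) p.176 (bookkeeping)] -/
theorem exists_guarded_record₁₃CCoP_b10_main_of_theta13Numerics_provisosCore_two (F : T4Family) {n : Stage12Numerics} {ε₂₉ : ℝ} (hn : n.Pos) (hε' : 0 < ε₂₉)
    (hP : (theta13LiveOfNumerics F 2 n ε₂₉ (zeta316OfRecord F 2 n.ν n.τ9.M n.A₁) (RzOfRecord F 2) (ZtOfRecord F 2)).Provisos₁₃Core F 2)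
    (hUV : PrintedUV3V 2 F.L) :
    ∃ (θ : Stage13Params F 2) (h : θ.Provisos₁₃Core F 2) (w : WorldP), (θ.ZtUnity F 2 ∧ θ.SlotsNondegenerate₁₃ F 2) ∧ θ.Admissible F 2 ∧
      IsRecordOfRecord₁₃CCoP F 2 (datumOfRecord₁₃CoP F 2 θ h) w ∧ ∀ P : B12.RunParams, Dag.B10_main (leavesP w P) := by
  obtain ⟨w, hR, -, -, -, hN⟩ := exists_world₁₃CCoP_b10_main_at_theta13LiveOfNumerics F 2 hn hε' hP hUV
  exact ⟨_, hP, w, ⟨ztUnity_theta13LiveOfNumerics F 2 n ε₂₉, slotsNondegenerate₁₃_theta13LiveOfNumerics_of_hasResiduals F 2 n ε₂₉⟩,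
    admissible_theta13LiveOfNumerics F 2 _ _ _ hn hε', hR, hN⟩

end Numerics

/-! ## §2 ON THE TWO-LETTER STAGE-13 WITNESS FAMILY `θ₁₃(ε₀, ε₂₉) = theta13LiveOfFamily₂ F N ε₀ ε₂₉ (zeta316OfRecord F N (numerics7OfFamily ε₀) 1 1) (RzOfRecord F N) (ZtOfRecord F N)`
(block size `F.L`, window `1∕2`) — the member `n := stage12NumericsOfFamily ε₀` of §1; the witness of record is `(ε₀, ε₂₉) = (1, ⅛)` -/

section Family₂
variable (F : T4Family) (N : ℕ) [NeZero N] {ε₀ ε₂₉ : ℝ}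

/-- **N08's SHARE AT ANY MEMBER `θ₁₃(ε₀, ε₂₉)` COSTS `PrintedUV3V N F.L`** (plus `hP : Provisos₁₃Core` there and the signs `0 < ε₀`, `0 < ε₂₉`; admissibility is K0a's
`admissible_theta13LiveOfFamily₂`): a world of the member's CoP datum (`w.γ = 1∕2`, `w.L = F.L`) bound over the [B10]-pinned CoP view, a ₁₃CCoP record carrying N08 at every run.
[cite: Balaban1985UV3, Thm 1 p.257, Thm 2 p.272; Balaban1989LargeFieldII, Thm 1 + (0.1) pp.355–356; Balaban1987RG1, (1.2) p.260, (2.9) p.266 (bookkeeping)] -/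
theorem exists_world₁₃CCoP_b10_main_at_theta13LiveOfFamily₂ (hε : 0 < ε₀) (hε' : 0 < ε₂₉)
    (hP : (theta13LiveOfFamily₂ F N ε₀ ε₂₉ (zeta316OfRecord F N (numerics7OfFamily ε₀) 1 1) (RzOfRecord F N) (ZtOfRecord F N)).Provisos₁₃Core F N)
    (hUV : PrintedUV3V N F.L) :
    ∃ w : WorldP,
      IsRecordOfRecord₁₃CCoP F N
          (datumOfRecord₁₃CoP F N (theta13LiveOfFamily₂ F N ε₀ ε₂₉ (zeta316OfRecord F N (numerics7OfFamily ε₀) 1 1) (RzOfRecord F N) (ZtOfRecord F N)) hP) w ∧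
        w.γ = 1 / 2 ∧ w.L = (F.L : ℝ) ∧
        (∀ P, w.up P = upOfRecord₅C F N
          (((theta13LiveOfFamily₂ F N ε₀ ε₂₉ (zeta316OfRecord F N (numerics7OfFamily ε₀) 1 1) (RzOfRecord F N) (ZtOfRecord F N)).pinB10 F N).toStage5₁₃CoP F N) P) ∧
        ∀ P : B12.RunParams, Dag.B10_main (leavesP w P) :=
  exists_world₁₃CCoP_b10_main_of_slot _ hP (admissible_theta13LiveOfFamily₂ F N _ _ _ hε hε') (γw := 1 / 2)
    ⟨one_half_pos, (theta13LiveOfFamily₂_γ F N ε₀ ε₂₉ _ _ _).symm.le⟩ hUV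

/-- **N08's CONJUNCT OF THE STAGE-13 NODES-∃, WITNESSED AT THE MEMBER `θ₁₃(ε₀, ε₂₉)`, `N = 2`** — from `hP : Provisos₁₃Core` there (HYPOTHESIS), `0 < ε₀`, `0 < ε₂₉` and
`PrintedUV3V 2 F.L`; guard (HYPOTHESIS-FREE) and admissibility are K0a's theorems BY NAME.  NOT the stub, NOT a discharge. [cite: Balaban1985UV3, Thm 1 p.257, Thm 2 p.272; Balaban1988Convergent, Thm 1 p.262, (3.16)–(3.22) pp.268–269; Balaban1989LargeFieldI, (0.3)–(0.4) p.176 (bookkeeping)] -/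
theorem exists_guarded_record₁₃CCoP_b10_main_of_theta13Family₂_provisosCore_two (F : T4Family) {ε₀ ε₂₉ : ℝ} (hε : 0 < ε₀) (hε' : 0 < ε₂₉)
    (hP : (theta13LiveOfFamily₂ F 2 ε₀ ε₂₉ (zeta316OfRecord F 2 (numerics7OfFamily ε₀) 1 1) (RzOfRecord F 2) (ZtOfRecord F 2)).Provisos₁₃Core F 2)
    (hUV : PrintedUV3V 2 F.L) :
    ∃ (θ : Stage13Params F 2) (h : θ.Provisos₁₃Core F 2) (w : WorldP), (θ.ZtUnity F 2 ∧ θ.SlotsNondegenerate₁₃ F 2) ∧ θ.Admissible F 2 ∧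
      IsRecordOfRecord₁₃CCoP F 2 (datumOfRecord₁₃CoP F 2 θ h) w ∧ ∀ P : B12.RunParams, Dag.B10_main (leavesP w P) := by
  obtain ⟨w, hR, -, -, -, hN⟩ := exists_world₁₃CCoP_b10_main_at_theta13LiveOfFamily₂ F 2 hε hε' hP hUV
  exact ⟨_, hP, w, ⟨ztUnity_theta13LiveOfFamily₂ F 2 ε₀ ε₂₉, slotsNondegenerate₁₃_theta13LiveOfFamily₂_of_hasResiduals F 2 ε₀ ε₂₉⟩,
    admissible_theta13LiveOfFamily₂ F 2 _ _ _ hε hε', hR, hN⟩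

end Family₂

/-! ## §3 THE SUPPLIER CURRENCIES OF THE SLOT AT THE FAMILY'S OWN BLOCK SIZE `F.L` — (u) uniform leaf systems, (r) «relative to (5)», (o) per-run data with a run-uniform
O(1) — on print's `F.L`-runs `runObjects₀T N 𝔗 (Backgrounds.ofPrint N F.L)` at a version `𝔗 : TFamily₃ N F.L` of print's transformations (2) -/

section SupplierNumerics
variable (F : T4Family) (N : ℕ) [NeZero N] {n : Stage12Numerics} {ε₂₉ : ℝ}

/-- **CURRENCY (u) AT THE MEMBER `θ₁₃(n, ε₂₉)` — UNIFORM LEAF SYSTEMS AT BLOCK SIZE `F.L`**: a version `𝔗` of print's transformations on the `F.L`-runs, admissible constants `c`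
and uniform leaf systems on print's run objects give N08's world at the member's datum (dag-n08-a's supplier face `printedUV3V_of_uniformLeafSystems_at` BY NAME into §1).
[cite: Balaban1985UV3, Thm 1 p.257, Thm 2 p.272, Sect. D pp.272–275; Balaban1985Averaging, (10) p.19] -/
theorem exists_world₁₃CCoP_b10_main_at_theta13LiveOfNumerics_of_uniformLeafSystemsG (hn : n.Pos) (hε' : 0 < ε₂₉)
    (hP : (theta13LiveOfNumerics F N n ε₂₉ (zeta316OfRecord F N n.ν n.τ9.M n.A₁) (RzOfRecord F N) (ZtOfRecord F N)).Provisos₁₃Core F N)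
    (𝔗 : TFamily₃ N F.L) (c : Consts F.L) (hc : c.Adm) (hU : UniformLeafSystemsG N (runObjects₀T N 𝔗 (Backgrounds.ofPrint N F.L)) c) :
    ∃ w : WorldP,
      IsRecordOfRecord₁₃CCoP F N
          (datumOfRecord₁₃CoP F N (theta13LiveOfNumerics F N n ε₂₉ (zeta316OfRecord F N n.ν n.τ9.M n.A₁) (RzOfRecord F N) (ZtOfRecord F N)) hP) w ∧
        w.γ = n.γ ∧ w.L = (F.L : ℝ) ∧
        (∀ P, w.up P = upOfRecord₅C F N
          (((theta13LiveOfNumerics F N n ε₂₉ (zeta316OfRecord F N n.ν n.τ9.M n.A₁) (RzOfRecord F N) (ZtOfRecord F N)).pinB10 F N).toStage5₁₃CoP F N) P) ∧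
        ∀ P : B12.RunParams, Dag.B10_main (leavesP w P) :=
  exists_world₁₃CCoP_b10_main_at_theta13LiveOfNumerics F N hn hε' hP (printedUV3V_of_uniformLeafSystems_at 𝔗 ⟨c, hc, hU⟩)

/-- **CURRENCY (r) AT THE MEMBER — «RELATIVE TO (5)»**: a version `𝔗`, admissible constants `c`, Thm 1's bounds (5) in the compact reading on the `F.L`-runs (LOCATED HYPOTHESIS
`h5`, print's «O(1) independent of ε, k», p. 257 L1) and per-run representation data `hdata` give N08's world at the member's datum (dag-n08-e's supplier face
`printedUV3V_of_thm1Compact_perRun` BY NAME). [cite: Balaban1985UV3, Thm 1 p.257 (compact reading), Thm 2 p.272, Sect. D pp.272–275] -/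
theorem exists_world₁₃CCoP_b10_main_at_theta13LiveOfNumerics_of_thm1Compact_perRun (hn : n.Pos) (hε' : 0 < ε₂₉)
    (hP : (theta13LiveOfNumerics F N n ε₂₉ (zeta316OfRecord F N n.ν n.τ9.M n.A₁) (RzOfRecord F N) (ZtOfRecord F N)).Provisos₁₃Core F N)
    (𝔗 : TFamily₃ N F.L) (c : Consts F.L) (hc : c.Adm)
    (h5 : B10.Thm1PrintedCompact (runsAtG N (runObjects₀T N 𝔗 (Backgrounds.ofPrint N F.L)) c))
    (hdata : ∀ S : Family F.L c.eps0, ∃ (C : B10Assembly.Consts) (W : SectB.TowerObjects S.1 (SU N)),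
      W.toRunObjects = runObjects₀T N 𝔗 (Backgrounds.ofPrint N F.L) c S.1 ∧ Nonempty (B10Assembly.LeafSystem C W.pin.toTowerRun)) :
    ∃ w : WorldP,
      IsRecordOfRecord₁₃CCoP F N
          (datumOfRecord₁₃CoP F N (theta13LiveOfNumerics F N n ε₂₉ (zeta316OfRecord F N n.ν n.τ9.M n.A₁) (RzOfRecord F N) (ZtOfRecord F N)) hP) w ∧
        w.γ = n.γ ∧ w.L = (F.L : ℝ) ∧
        (∀ P, w.up P = upOfRecord₅C F N
          (((theta13LiveOfNumerics F N n ε₂₉ (zeta316OfRecord F N n.ν n.τ9.M n.A₁) (RzOfRecord F N) (ZtOfRecord F N)).pinB10 F N).toStage5₁₃CoP F N) P) ∧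
        ∀ P : B12.RunParams, Dag.B10_main (leavesP w P) :=
  exists_world₁₃CCoP_b10_main_at_theta13LiveOfNumerics F N hn hε' hP (printedUV3V_of_thm1Compact_perRun N F.L 𝔗 c hc h5 hdata)

/-- **CURRENCY (o) AT THE MEMBER — PER-RUN DATA WITH A RUN-UNIFORM O(1)**: a version `𝔗`, admissible constants `c`, and per-run representation data on the `F.L`-runs whose
displayed O(1) is bounded by one `O` across the family give N08's world at the member's datum (dag-n08-a's sharpest data currency `printedUV3V_of_perRunUniformO1` BY NAME).
[cite: Balaban1985UV3, Thm 1 p.257 L1, Thm 2 p.272, Sect. D pp.272–274] -/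
theorem exists_world₁₃CCoP_b10_main_at_theta13LiveOfNumerics_of_perRunUniformO1 (hn : n.Pos) (hε' : 0 < ε₂₉)
    (hP : (theta13LiveOfNumerics F N n ε₂₉ (zeta316OfRecord F N n.ν n.τ9.M n.A₁) (RzOfRecord F N) (ZtOfRecord F N)).Provisos₁₃Core F N)
    (𝔗 : TFamily₃ N F.L) (c : Consts F.L) (hc : c.Adm) (O : ℝ → ℝ → ℝ)
    (h : ∀ S : Family F.L c.eps0, ∃ (C : B10Assembly.Consts) (W : SectB.TowerObjects S.1 (SU N)),
      W.toRunObjects = runObjects₀T N 𝔗 (Backgrounds.ofPrint N F.L) c S.1 ∧ Nonempty (B10Assembly.LeafSystem C W.pin.toTowerRun) ∧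
        ∀ gmin gmax : ℝ, 0 < gmin → gmin ≤ gmax → B10Assembly.O1 C gmin gmax ≤ O gmin gmax) :
    ∃ w : WorldP,
      IsRecordOfRecord₁₃CCoP F N
          (datumOfRecord₁₃CoP F N (theta13LiveOfNumerics F N n ε₂₉ (zeta316OfRecord F N n.ν n.τ9.M n.A₁) (RzOfRecord F N) (ZtOfRecord F N)) hP) w ∧
        w.γ = n.γ ∧ w.L = (F.L : ℝ) ∧
        (∀ P, w.up P = upOfRecord₅C F N
          (((theta13LiveOfNumerics F N n ε₂₉ (zeta316OfRecord F N n.ν n.τ9.M n.A₁) (RzOfRecord F N) (ZtOfRecord F N)).pinB10 F N).toStage5₁₃CoP F N) P) ∧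
        ∀ P : B12.RunParams, Dag.B10_main (leavesP w P) :=
  exists_world₁₃CCoP_b10_main_at_theta13LiveOfNumerics F N hn hε' hP (printedUV3V_of_perRunUniformO1 N F.L 𝔗 c hc O h)

end SupplierNumerics

section SupplierGuarded
variable (F : T4Family) {n : Stage12Numerics} {ε₂₉ : ℝ}

/-- **CURRENCY (u) INTO N08's CONJUNCT OF A CORE-KEYED ₁₃ NODES-∃ AT THE MEMBER `θL F n ε₂₉`, `N = 2`**: the signs, the Core provisos at the member (`hP`, HYPOTHESIS, opaque),
and — in place of `PrintedUV3V 2 F.L` — a version `𝔗 : TFamily₃ 2 F.L` of print's transformations with admissible constants and UNIFORM LEAF SYSTEMS on print's `F.L`-run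
objects for SU(2) (dag-n08-a's supplier face BY NAME into §1).  What a d = 3 lane END theorem must deliver for N08 AT THE RECORD, in the uniform currency. [cite: Balaban1985UV3, Thm 1 p.257, Thm 2 p.272, Sect. D pp.272–275; Balaban1988Convergent, (3.16)–(3.22) pp.268–269 (bookkeeping)] -/
theorem exists_guarded_record₁₃CCoP_b10_main_of_theta13Numerics_provisosCore_two_of_uniformLeafSystemsG (hn : n.Pos) (hε' : 0 < ε₂₉)
    (hP : (theta13LiveOfNumerics F 2 n ε₂₉ (zeta316OfRecord F 2 n.ν n.τ9.M n.A₁) (RzOfRecord F 2) (ZtOfRecord F 2)).Provisos₁₃Core F 2)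
    (𝔗 : TFamily₃ 2 F.L) (c : Consts F.L) (hc : c.Adm) (hU : UniformLeafSystemsG 2 (runObjects₀T 2 𝔗 (Backgrounds.ofPrint 2 F.L)) c) :
    ∃ (θ : Stage13Params F 2) (h : θ.Provisos₁₃Core F 2) (w : WorldP), (θ.ZtUnity F 2 ∧ θ.SlotsNondegenerate₁₃ F 2) ∧ θ.Admissible F 2 ∧
      IsRecordOfRecord₁₃CCoP F 2 (datumOfRecord₁₃CoP F 2 θ h) w ∧ ∀ P : B12.RunParams, Dag.B10_main (leavesP w P) :=
  exists_guarded_record₁₃CCoP_b10_main_of_theta13Numerics_provisosCore_two F hn hε' hP (printedUV3V_of_uniformLeafSystems_at 𝔗 ⟨c, hc, hU⟩)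

/-- **CURRENCY (r) INTO N08's CONJUNCT AT THE MEMBER, `N = 2`** — the signs, the Core provisos at the member, a version `𝔗`, admissible `c`, Thm 1's bounds (5) in the compact
reading on the `F.L`-runs for SU(2) (LOCATED HYPOTHESIS `h5`) and per-run representation data `hdata` (dag-n08-e's currency BY NAME: what the END theorem must add to its per-run
towers is exactly `h5`). [cite: Balaban1985UV3, Thm 1 p.257 (compact reading), Thm 2 p.272, Sect. D pp.272–275; Balaban1988Convergent, (3.16)–(3.22) pp.268–269 (bookkeeping)] -/
theorem exists_guarded_record₁₃CCoP_b10_main_of_theta13Numerics_provisosCore_two_of_thm1Compact_perRun (hn : n.Pos) (hε' : 0 < ε₂₉)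
    (hP : (theta13LiveOfNumerics F 2 n ε₂₉ (zeta316OfRecord F 2 n.ν n.τ9.M n.A₁) (RzOfRecord F 2) (ZtOfRecord F 2)).Provisos₁₃Core F 2)
    (𝔗 : TFamily₃ 2 F.L) (c : Consts F.L) (hc : c.Adm)
    (h5 : B10.Thm1PrintedCompact (runsAtG 2 (runObjects₀T 2 𝔗 (Backgrounds.ofPrint 2 F.L)) c))
    (hdata : ∀ S : Family F.L c.eps0, ∃ (C : B10Assembly.Consts) (W : SectB.TowerObjects S.1 (SU 2)),
      W.toRunObjects = runObjects₀T 2 𝔗 (Backgrounds.ofPrint 2 F.L) c S.1 ∧ Nonempty (B10Assembly.LeafSystem C W.pin.toTowerRun)) :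
    ∃ (θ : Stage13Params F 2) (h : θ.Provisos₁₃Core F 2) (w : WorldP), (θ.ZtUnity F 2 ∧ θ.SlotsNondegenerate₁₃ F 2) ∧ θ.Admissible F 2 ∧
      IsRecordOfRecord₁₃CCoP F 2 (datumOfRecord₁₃CoP F 2 θ h) w ∧ ∀ P : B12.RunParams, Dag.B10_main (leavesP w P) :=
  exists_guarded_record₁₃CCoP_b10_main_of_theta13Numerics_provisosCore_two F hn hε' hP (printedUV3V_of_thm1Compact_perRun 2 F.L 𝔗 c hc h5 hdata)

/-- **CURRENCY (o) INTO N08's CONJUNCT AT THE MEMBER, `N = 2`** — the signs, the Core provisos at the member, a version `𝔗`, admissible `c`, and per-run representation data on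
the `F.L`-runs whose displayed O(1) is bounded by one `O` across the family (dag-n08-a's sharpest data currency BY NAME). [cite: Balaban1985UV3, Thm 1 p.257 L1, Thm 2 p.272, Sect. D pp.272–274; Balaban1988Convergent, (3.16)–(3.22) pp.268–269 (bookkeeping)] -/
theorem exists_guarded_record₁₃CCoP_b10_main_of_theta13Numerics_provisosCore_two_of_perRunUniformO1 (hn : n.Pos) (hε' : 0 < ε₂₉)
    (hP : (theta13LiveOfNumerics F 2 n ε₂₉ (zeta316OfRecord F 2 n.ν n.τ9.M n.A₁) (RzOfRecord F 2) (ZtOfRecord F 2)).Provisos₁₃Core F 2)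
    (𝔗 : TFamily₃ 2 F.L) (c : Consts F.L) (hc : c.Adm) (O : ℝ → ℝ → ℝ)
    (h : ∀ S : Family F.L c.eps0, ∃ (C : B10Assembly.Consts) (W : SectB.TowerObjects S.1 (SU 2)),
      W.toRunObjects = runObjects₀T 2 𝔗 (Backgrounds.ofPrint 2 F.L) c S.1 ∧ Nonempty (B10Assembly.LeafSystem C W.pin.toTowerRun) ∧
        ∀ gmin gmax : ℝ, 0 < gmin → gmin ≤ gmax → B10Assembly.O1 C gmin gmax ≤ O gmin gmax) :
    ∃ (θ : Stage13Params F 2) (h : θ.Provisos₁₃Core F 2) (w : WorldP), (θ.ZtUnity F 2 ∧ θ.SlotsNondegenerate₁₃ F 2) ∧ θ.Admissible F 2 ∧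
      IsRecordOfRecord₁₃CCoP F 2 (datumOfRecord₁₃CoP F 2 θ h) w ∧ ∀ P : B12.RunParams, Dag.B10_main (leavesP w P) :=
  exists_guarded_record₁₃CCoP_b10_main_of_theta13Numerics_provisosCore_two F hn hε' hP (printedUV3V_of_perRunUniformO1 2 F.L 𝔗 c hc O h)

end SupplierGuarded

end Summit.QuantumFields.YangMills.BalabanUVNodes.N08AtRecord13CoPFamily

end
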